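import Literature.Geometry.Kaehler.TorusDolbeaultCompactness
import Literature.Geometry.Kaehler.TorusDolbeaultLocalData
import Literature.Analysis.FunctionSpaces.FinsetCauchyExtraction
import Mathlib.Geometry.Manifold.PartitionOfUnity
import HarnessLib

/-!
# Compactness of `Δ_∂̄` on a compact Hermitian manifold (Warner's Theorem 6.6 for `Δ_∂̄`)

F. W. Warner, GTM 94 (1983), Theorem 6.6 (proved in 6.33): a sequence `α_n` of smooth forms with
`‖α_n‖` and `‖Δα_n‖` bounded has an `L²`-Cauchy subsequence. Following 6.33 we cover `M` by finitely
many coordinate cubes carrying good cut-off data (`exists_goodData`), choose a subordinate smooth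
partition of unity `φ_l` and plateau functions `τ_l`, extract one subsequence making every
`φ_l α_n` Cauchy (`CL2SmoothForms.exists_subseq_cauchySeq_fun_smul`, iterated by
`exists_strictMono_forall_cauchySeq`) and sum (`α = ∑ φ_l α`). Main results:
`CL2SmoothForms.exists_subseq_cauchySeq_of_local` (the gluing) and
`CL2SmoothForms.dolbeaultLaplacian_compact{,_zero,_top}` (the three degree cases of `Δ_∂̄`).

## References

* F. W. Warner, GTM 94 (1983), Thm. 6.6, 6.33. [WarnerGTM94]
-/

noncomputable section

open scoped Manifold ContDiff Topology NNReal ENNReal RealInnerProductSpace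
open Bundle Set Function Module Metric Filter
open Literature.Analysis.FunctionSpaces Literature.NumberTheory.Transcendental

set_option maxSynthPendingDepth 2

namespace Literature.Geometry.Kaehler

variable {E : Type*} [NormedAddCommGroup E] [NormedSpace ℂ E] [FiniteDimensional ℂ E]
  {n : ℕ} [Fact (finrank ℝ E = n)] [MeasurableSpace E] [BorelSpace E]
  {M : Type*} [TopologicalSpace M] [ChartedSpace E M] [T2Space M] [CompactSpace M]
  [IsManifold 𝓘(ℂ, E) ω M] [IsManifold 𝓘(ℝ, E) ∞ M]
  [RiemannianBundle (fun x : M ↦ TangentSpace 𝓘(ℝ, E) x)]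
  [IsContMDiffRiemannianBundle 𝓘(ℝ, E) ∞ E (fun x : M ↦ TangentSpace 𝓘(ℝ, E) x)]
  (o : (x : M) → Orientation ℝ (TangentSpace 𝓘(ℝ, E) x) (Fin n)) {k m : ℕ}
  [Fact (IsSmoothForm (riemannianVolumeForm o))]

/-! ### Gluing local extractions -/

omit [IsManifold 𝓘(ℂ, E) ω M] in
/-- **Gluing** (Warner 6.33, last paragraph): if every point has an open neighbourhood `O` on which,
for all cut-offs `φ` (with plateau `τ` supported in `O`), bounded sequences with bounded `ΔL` have
subsequences making `φ u` Cauchy, then bounded sequences with bounded `ΔL` have Cauchy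
subsequences. [cite: WarnerGTM94, 6.33] -/
theorem CL2SmoothForms.exists_subseq_cauchySeq_of_local {K : ℕ} (ΔL : CL2SmoothForms o K → CL2SmoothForms o K)
    (hloc : ∀ x : M, ∃ O : Set M, IsOpen O ∧ x ∈ O ∧ ∀ {φ τ : M → ℝ} (hφ : ContMDiff 𝓘(ℝ, E) 𝓘(ℝ) ∞ φ),
      ContMDiff 𝓘(ℝ, E) 𝓘(ℝ) ∞ τ → (∀ y, |φ y| ≤ 1) → (∀ y, |τ y| ≤ 1) →
      (∀ y, φ y ≠ 0 → ∀ᶠ w in 𝓝 y, τ w = 1) → (∀ y, τ y ≠ 0 → y ∈ O) →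
      ∀ (u : ℕ → CL2SmoothForms o K) (c : ℝ), (∀ i, ‖u i‖ ≤ c) → (∀ i, ‖ΔL (u i)‖ ≤ c) →
        ∃ ψ : ℕ → ℕ, StrictMono ψ ∧ CauchySeq (fun i ↦ CL2SmoothForms.mk o (φ • CL2SmoothForms.toForm o (u (ψ i)))
          ((CL2SmoothForms.isSmoothForm_toForm o _).fun_smul' hφ)))
    (u : ℕ → CL2SmoothForms o K) (c : ℝ) (hb : ∀ i, ‖u i‖ ≤ c) (hΔ : ∀ i, ‖ΔL (u i)‖ ≤ c) :
    ∃ ψ : ℕ → ℕ, StrictMono ψ ∧ CauchySeq (u ∘ ψ) := by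
  classical
  choose O hO hxO hP using hloc
  -- a finite subcover
  obtain ⟨t, ht⟩ := isCompact_univ.elim_finite_subcover O hO (fun x _ ↦ mem_iUnion.2 ⟨x, hxO x⟩)
  -- a smooth partition of unity subordinate to it, and plateau functions
  obtain ⟨ρ, hρ⟩ := SmoothPartitionOfUnity.exists_isSubordinate 𝓘(ℝ, E) isClosed_univ (fun l : t ↦ O l)
    (fun l ↦ hO l) (fun x hx ↦ by
      obtain ⟨l, hl, hx'⟩ := mem_iUnion₂.1 (ht hx)
      exact mem_iUnion.2 ⟨⟨l, hl⟩, hx'⟩)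
  have hτex : ∀ l : t, ∃ τ : C^∞⟮𝓘(ℝ, E), M; 𝓘(ℝ), ℝ⟯, (∀ᶠ x in 𝓝ˢ (O l)ᶜ, τ x = 0) ∧
      (∀ᶠ x in 𝓝ˢ (tsupport (ρ l)), τ x = 1) ∧ ∀ x, τ x ∈ Icc (0 : ℝ) 1 := fun l ↦
    exists_contMDiffMap_zero_one_nhds_of_isClosed 𝓘(ℝ, E) (hO l).isClosed_compl (isClosed_tsupport _)
      (disjoint_compl_left_iff.2 (hρ l))
  choose τ hτ0 hτ1 hτI using hτex
  -- the pieces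
  set T : t → CL2SmoothForms o K → CL2SmoothForms o K := fun l v ↦
    CL2SmoothForms.mk o ((ρ l : M → ℝ) • CL2SmoothForms.toForm o v)
      ((CL2SmoothForms.isSmoothForm_toForm o _).fun_smul' (ρ l).contMDiff) with hT
  set P : (ℕ → CL2SmoothForms o K) → Prop := fun v ↦ ∃ c : ℝ, ∀ i, ‖v i‖ ≤ c ∧ ‖ΔL (v i)‖ ≤ c with hPdef
  obtain ⟨ψ, hψ, hC⟩ := exists_strictMono_forall_cauchySeq (Finset.univ : Finset t) T P
    (fun v φ' _ ⟨c', hc'⟩ ↦ ⟨c', fun i ↦ hc' (φ' i)⟩)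
    (fun l _ v ⟨c', hc'⟩ ↦ hP (l : M) (ρ l).contMDiff (τ l).contMDiff
      (fun y ↦ abs_le.2 ⟨by linarith [ρ.nonneg l y], ρ.le_one l y⟩)
      (fun y ↦ abs_le.2 ⟨by linarith [(hτI l y).1], (hτI l y).2⟩)
      (fun y hy ↦ (hτ1 l).filter_mono (nhds_le_nhdsSet (subset_tsupport _ (mem_support.2 hy))))
      (fun y hy ↦ by
        by_contra hyO
        exact hy ((hτ0 l).self_of_nhdsSet y hyO))
      v c' (fun i ↦ (hc' i).1) (fun i ↦ (hc' i).2))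
    u ⟨c, fun i ↦ ⟨hb i, hΔ i⟩⟩
  refine ⟨ψ, hψ, ?_⟩
  -- `u = ∑ φ_l u`
  have hsum : ∀ v : CL2SmoothForms o K, ∑ l ∈ (Finset.univ : Finset t), T l v = v := fun v ↦ by
    apply (CL2SmoothForms.toForm_inj o).1
    change CL2SmoothForms.toFormₗ o (∑ l ∈ (Finset.univ : Finset t), T l v) = CL2SmoothForms.toForm o v
    rw [map_sum]
    have hl : ∀ l, CL2SmoothForms.toFormₗ o (T l v) = (ρ l : M → ℝ) • CL2SmoothForms.toForm o v := fun l ↦ rfl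
    simp only [hl]
    funext x
    rw [Finset.sum_apply]
    simp only [Pi.smul_apply']
    rw [← Finset.sum_smul, ← finsum_eq_sum_of_fintype, ρ.sum_eq_one (mem_univ x), one_smul]
  have : u ∘ ψ = fun i ↦ ∑ l ∈ (Finset.univ : Finset t), T l (u (ψ i)) := funext fun i ↦ (hsum _).symm
  rw [this]
  exact cauchySeq_finset_sum _ fun l hl ↦ hC l hl

/-! ### The open cube neighbourhoods -/

omit [MeasurableSpace E] [BorelSpace E] [T2Space M] [CompactSpace M] [IsManifold 𝓘(ℂ, E) ω M]
  [RiemannianBundle (fun x : M ↦ TangentSpace 𝓘(ℝ, E) x)]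
  [IsContMDiffRiemannianBundle 𝓘(ℝ, E) ∞ E (fun x : M ↦ TangentSpace 𝓘(ℝ, E) x)]
  [FiniteDimensional ℂ E] [Fact (finrank ℝ E = n)] [IsManifold 𝓘(ℝ, E) ∞ M] in
/-- The open chart neighbourhood of `p` attached to cut-off data: the chart preimage of the open
inner cube. [folklore] -/
theorem exists_open_cube_nhds {p : M} {A : E ≃L[ℝ] EuclideanSpace ℝ (Fin n)} (𝒞 : CubeCutoff p A) :
    ∃ O : Set M, IsOpen O ∧ p ∈ O ∧ ∀ y ∈ O, y ∈ (extChartAt 𝓘(ℝ, E) p).source ∧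
      extChartAt 𝓘(ℝ, E) p y ∈ cubeRegion A (extChartAt 𝓘(ℝ, E) p p) 𝒞.ρ := by
  set W : Set E := cubeMap A (extChartAt 𝓘(ℝ, E) p p) ⁻¹' ball (Torus.cubeCenter (Fin n)) 𝒞.ρ with hW
  have hWo : IsOpen W := isOpen_ball.preimage (cubeMap A _).continuous
  refine ⟨(extChartAt 𝓘(ℝ, E) p).source ∩ extChartAt 𝓘(ℝ, E) p ⁻¹' W,
    (continuousOn_extChartAt p).isOpen_inter_preimage (isOpen_extChartAt_source p) hWo,
    ⟨mem_extChartAt_source p, ?_⟩, fun y hy ↦ ⟨hy.1, ball_subset_closedBall hy.2⟩⟩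
  rw [Set.mem_preimage, hW, Set.mem_preimage, cubeMap_self]
  exact mem_ball_self 𝒞.ρ_pos

/-! ### Warner's Theorem 6.6 for `Δ_∂̄` -/

/-- **Theorem 6.6 for `Δ_∂̄`, generic degree `(k+1) + (m+1) = n`**: on a compact Hermitian manifold, a
sequence in `A^{k+1}(M; ℂ)` with `‖u_i‖` and `‖Δ_∂̄ u_i‖` bounded has an `L²`-Cauchy subsequence.
[cite: WarnerGTM94, Thm. 6.6] -/
theorem CL2SmoothForms.dolbeaultLaplacian_compact
    (hH : ∀ (x : M) (v w : TangentSpace 𝓘(ℝ, E) x), ⟪tangentJ E x v, tangentJ E x w⟫ = ⟪v, w⟫)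
    (h : (k + 1) + (m + 1) = n) (u : ℕ → CL2SmoothForms o (k + 1)) (c : ℝ) (hb : ∀ i, ‖u i‖ ≤ c)
    (hΔ : ∀ i, ‖CL2SmoothForms.dolbeaultLaplacian o h (u i)‖ ≤ c) :
    ∃ ψ : ℕ → ℕ, StrictMono ψ ∧ CauchySeq (u ∘ ψ) := by
  have ho : IsSmoothForm (riemannianVolumeForm o) := Fact.out
  haveI : IsContinuousRiemannianBundle E (fun x : M ↦ TangentSpace 𝓘(ℝ, E) x) :=
    isContinuousRiemannianBundle_of_isContMDiffRiemannianBundle 𝓘(ℝ, E) ∞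
  refine CL2SmoothForms.exists_subseq_cauchySeq_of_local o _ (fun x ↦ ?_) u c hb hΔ
  obtain ⟨A, 𝒞, κ, ε, εs, hκ, hell, hpert, hε, hsign⟩ :=
    exists_goodData o ho hH h (show (k + 1 + 1) + m = n by omega) x
  obtain ⟨O, hO, hxO, hOK⟩ := exists_open_cube_nhds 𝒞
  exact ⟨O, hO, hxO, fun hφ hτ hφ1 hτ1 hτφ hKτ u c hb hΔ ↦
    CL2SmoothForms.exists_subseq_cauchySeq_fun_smul o h 𝒞 hκ hell hpert hε hsign hφ hτ hφ1 hτ1 hτφ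
      (fun y hy ↦ hOK y (hKτ y hy)) u hb hΔ⟩

/-- **Theorem 6.6 for `Δ_∂̄`, degree `0`** (`0 + (m+1) = n`). [cite: WarnerGTM94, Thm. 6.6] -/
theorem CL2SmoothForms.dolbeaultLaplacian_compact_zero
    (hH : ∀ (x : M) (v w : TangentSpace 𝓘(ℝ, E) x), ⟪tangentJ E x v, tangentJ E x w⟫ = ⟪v, w⟫)
    (h : 0 + (m + 1) = n) (u : ℕ → CL2SmoothForms o 0) (c : ℝ) (hb : ∀ i, ‖u i‖ ≤ c)
    (hΔ : ∀ i, ‖CL2SmoothForms.dolbeaultLaplacian o h (u i)‖ ≤ c) :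
    ∃ ψ : ℕ → ℕ, StrictMono ψ ∧ CauchySeq (u ∘ ψ) := by
  have ho : IsSmoothForm (riemannianVolumeForm o) := Fact.out
  haveI : IsContinuousRiemannianBundle E (fun x : M ↦ TangentSpace 𝓘(ℝ, E) x) :=
    isContinuousRiemannianBundle_of_isContMDiffRiemannianBundle 𝓘(ℝ, E) ∞
  refine CL2SmoothForms.exists_subseq_cauchySeq_of_local o _ (fun x ↦ ?_) u c hb hΔ
  obtain ⟨A, 𝒞, κ, ε, εs, hκ, hell, hpert, hε, hsign⟩ :=
    exists_goodDataZero o ho hH (show (0 + 1) + m = n by omega) x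
  obtain ⟨O, hO, hxO, hOK⟩ := exists_open_cube_nhds 𝒞
  exact ⟨O, hO, hxO, fun hφ hτ hφ1 hτ1 hτφ hKτ u c hb hΔ ↦
    CL2SmoothForms.exists_subseq_cauchySeq_fun_smul_zero o h 𝒞 hκ hell hpert hε hsign hφ hτ hφ1 hτ1 hτφ
      (fun y hy ↦ hOK y (hKτ y hy)) u hb hΔ⟩

/-- **Theorem 6.6 for `Δ_∂̄`, top degree** (`(k+1) + 0 = n`). [cite: WarnerGTM94, Thm. 6.6] -/
theorem CL2SmoothForms.dolbeaultLaplacian_compact_top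
    (hH : ∀ (x : M) (v w : TangentSpace 𝓘(ℝ, E) x), ⟪tangentJ E x v, tangentJ E x w⟫ = ⟪v, w⟫)
    (h : (k + 1) + 0 = n) (u : ℕ → CL2SmoothForms o (k + 1)) (c : ℝ) (hb : ∀ i, ‖u i‖ ≤ c)
    (hΔ : ∀ i, ‖CL2SmoothForms.dolbeaultLaplacian o h (u i)‖ ≤ c) :
    ∃ ψ : ℕ → ℕ, StrictMono ψ ∧ CauchySeq (u ∘ ψ) := by
  have ho : IsSmoothForm (riemannianVolumeForm o) := Fact.out
  haveI : IsContinuousRiemannianBundle E (fun x : M ↦ TangentSpace 𝓘(ℝ, E) x) :=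
    isContinuousRiemannianBundle_of_isContMDiffRiemannianBundle 𝓘(ℝ, E) ∞
  refine CL2SmoothForms.exists_subseq_cauchySeq_of_local o _ (fun x ↦ ?_) u c hb hΔ
  obtain ⟨A, 𝒞, κ, ε, εs, hκ, hell, hpert, hε, hsign⟩ := exists_goodDataTop o ho hH h x
  obtain ⟨O, hO, hxO, hOK⟩ := exists_open_cube_nhds 𝒞
  exact ⟨O, hO, hxO, fun hφ hτ hφ1 hτ1 hτφ hKτ u c hb hΔ ↦
    CL2SmoothForms.exists_subseq_cauchySeq_fun_smul_top o h 𝒞 hκ hell hpert hε hsign hφ hτ hφ1 hτ1 hτφ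
      (fun y hy ↦ hOK y (hKτ y hy)) u hb hΔ⟩

end Literature.Geometry.Kaehler
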